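import Literature.NumberTheory.EllipticCurves.DivisionPolynomialCuspJets
import Mathlib.RingTheory.Ideal.Quotient.Operations
import HarnessLib

/-!
# `ψ₅` and `ψ₇` of `y² = x³ + ax + b` to first order at the cusp WITH INTEGER COEFFICIENTS
# (`62`, `380`; `308`, `3944`): the two congruences behind rational `5`- and `7`-torsion at an
# additive prime

HONEST FRAMING (cell `b2b-bsdres`, run/shared/lean/b2b/bsd-rank1-residual/, verbatim in every
file): the goal of the cell is to DELETE the COMBINATION-SHAPED residual classes of the
Birch–Swinnerton-Dyer formula for ALL analytic-rank `≤ 1` elliptic curves over `ℚ` — "full BSD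
formula for every rank `≤ 1` curve in class `C`" assembled STRICTLY from published theorems — so
that the rank-`≤ 1` remainder becomes exactly the CONSTRUCTION-SHAPED classes, which are TYPED
(missing-input `Prop`s), NOT attempted. This is not "finishing BSD". Sub-cell `additive-p2`
(X3♯(G-ord) / X4♯(G-ord)), generation 37: research route; no claim beyond the stated classes;
theorems only (pure commutative algebra), no definition, no named fact, nothing booked, no label
moved.

## What and why

The tree's `Literature.NumberTheory.EllipticCurves.CuspJets.preΨ'_eval_sub_cuspLinear_mem`
computes the univariate division polynomials `ψₙ` of the short curve `y² = x³ + ax + b` to first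
order in `(a, b)` at the cuspidal cubic, uniformly in `n`, over rings in which `840 = 2³·3·5·7`
is invertible (`w = 1/840` carries the denominators `60`, `210` of the closed forms
`n(n²−1)(n²+6)/60`, `n(n²−1)(n⁴+n²+15)/210`), and `MazurTorsionStepOneAtNProofs` turns this into
Mazur's Step 1 at `q = N` for `N ≥ 11`: no `N`-torsion in `E(ℚ_N)` at an ADDITIVE prime
`N ≥ 11`.  At `p = 5` and `p = 7` — the primes where the cell's potentially-good-ordinary
(G)-pairs concentrate (defect `4` lives at `5`, defects `3, 6` at `7`) — `840` is not a unit, and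
indeed rational `5`- and `7`-torsion WITH additive reduction at `p` exists (`X₁(5)`, `X₁(7)`).
This file supplies the two first-order expansions at `n = 5` and `n = 7` over an ARBITRARY
commutative ring, with their integer coefficients, by direct computation from Mathlib's recursion
(`WeierstrassCurve.preΨ'_odd`) and the closed forms of `Ψ₂Sq`, `Ψ₃`, `preΨ₄`:

* `eval_preΨ'_five` — the full closed form
  `ψ₅ = 5x¹² + 62ax¹⁰ + 380bx⁹ − 105a²x⁸ + 240abx⁷ − (300a³ + 240b²)x⁶ − 696a²bx⁵ − (125a⁴ + 1920ab²)x⁴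
        − (80a³b + 1600b³)x³ − (50a⁵ + 240a²b²)x² − (100a⁴b + 640ab³)x + a⁶ − 32a³b² − 256b⁴`;
* `eval_preΨ'_seven_of_b_zero`, `eval_preΨ'_seven_of_a_zero` — `ψ₇` on the two one-parameter
  families `y² = x³ + ax` (`j = 1728`) and `y² = x³ + b` (`j = 0`):
  `ψ₇ = 7x²⁴ + 308ax²² − 2954a²x²⁰ − ⋯ − a¹²`, `ψ₇ = 7x²⁴ + 3944bx²¹ − 42896b²x¹⁸ − ⋯ + 65536b⁸`;
* the CONGRUENCES used downstream (`Additive/LocalTorsionAdditiveFiveSeven`):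
  **`eval_preΨ'_five_sub_mem`** — `ψ₅(x) − (5x¹² + 380·b·x⁹) ∈ (a, b²)`, and
  **`eval_preΨ'_seven_sub_mem`** — `ψ₇(x) − (7x²⁴ + 308·a·x²²) ∈ (a², b)`;
  here `380 = 5·76` and `308 = 7·44` carry the factor `p`, while the complementary first-order
  coefficients `62` (of `a` in `ψ₅`) and `3944 = 7·563 + 3` (of `b` in `ψ₇`) are `p`-adic UNITS —
  which is exactly why a unit-abscissa `5`-torsion point on an additive fibre at `5` needs
  `v₅(a) = 1` (`v₅(c₄) = 1`: Kodaira types II, III) and a `7`-torsion point at `7` needs `v₇(b) = 1`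
  (`v₇(c₆) = 1`: type II), and cannot exist otherwise (`eval_preΨ'_five_sub_mem'`,
  `eval_preΨ'_seven_sub_mem'` record the complementary congruences `mod (a², b)` / `mod (a, b²)`).

Method: `preΨ'_five`/`preΨ'_seven` unfold Mathlib's `preNormEDS'` recursion
(`ψ₅ = preΨ₄·Ψ₂Sq² − Ψ₃³`, `ψ₇ = ψ₅·Ψ₃³ − preΨ₄³·Ψ₂Sq²`); the closed forms are `ring` identities; the
congruence for `ψ₇` is read in the quotient ring `R/(a², b)` (resp. `R/(a, b²)`), where the curve
becomes `y² = x³ + āx` with `ā² = 0` (resp. `y² = x³ + b̄`, `b̄² = 0`) — transport of `preΨ'` along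
a ring map is Mathlib's `WeierstrassCurve.map_preΨ'`.

References: [SilvermanAEC2009] J. H. Silverman, *The Arithmetic of Elliptic Curves*, 2nd ed.,
Exercise 3.7 (PDF pp. 97–98) (the recursion and the leading terms); the integer first-order
coefficients are computed here. [Mazur1977] B. Mazur, *Modular curves and the Eisenstein ideal*,
Publ. Math. IHÉS 47 (1977), Ch. III §5, Step 1 (the use at `q = N`).
-/

noncomputable section

open Polynomial

namespace Summit.BirchSwinnertonDyer.Rank1Residual.Additive.CuspTorsion

open Literature.NumberTheory.EllipticCurves.CuspJets (shortCurve)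

variable {R : Type*} [CommRing R]

/-! ## §1 The recursion at `n = 5` and `n = 7` (any Weierstrass curve) -/

/-- `ψ₅ = preΨ₄ · Ψ₂Sq² − Ψ₃³` (Mathlib's `preΨ'_odd` at `m = 0`: `ψ₅ = ψ₄ψ₂³ − ψ₁ψ₃³` with
`ψ₄ψ₂³ = preΨ₄ · ψ₂⁴`). [cite: SilvermanAEC2009, Exercise 3.7 (PDF pp. 97–98)] -/
theorem preΨ'_five (W : WeierstrassCurve R) :
    W.preΨ' 5 = W.preΨ₄ * W.Ψ₂Sq ^ 2 - W.Ψ₃ ^ 3 := by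
  have h := W.preΨ'_odd 0
  simp only [zero_add, Nat.reduceMul, Nat.reduceAdd, WeierstrassCurve.preΨ'_four,
    WeierstrassCurve.preΨ'_two, one_pow, mul_one, if_pos (show Even 0 from ⟨0, rfl⟩),
    WeierstrassCurve.preΨ'_one, WeierstrassCurve.preΨ'_three, one_mul] at h
  exact h

/-- `ψ₇ = ψ₅ · Ψ₃³ − preΨ₄³ · Ψ₂Sq²` (Mathlib's `preΨ'_odd` at `m = 1`: `ψ₇ = ψ₅ψ₃³ − ψ₂ψ₄³` with
`ψ₂ψ₄³ = preΨ₄³ · ψ₂⁴`). [cite: SilvermanAEC2009, Exercise 3.7 (PDF pp. 97–98)] -/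
theorem preΨ'_seven (W : WeierstrassCurve R) :
    W.preΨ' 7 = W.preΨ' 5 * W.Ψ₃ ^ 3 - W.preΨ₄ ^ 3 * W.Ψ₂Sq ^ 2 := by
  have h := W.preΨ'_odd 1
  simp only [Nat.reduceAdd, Nat.reduceMul, WeierstrassCurve.preΨ'_three,
    if_neg Nat.not_even_one, mul_one, WeierstrassCurve.preΨ'_two, WeierstrassCurve.preΨ'_four,
    one_mul] at h
  exact h

/-! ## §2 Closed forms for the short curve `y² = x³ + ax + b` -/

/-- `Ψ₂Sq(x) = 4x³ + 4ax + 4b` (`= (2y)²` on the curve). [folklore] -/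
theorem eval_Ψ₂Sq (a b x : R) : (shortCurve a b).Ψ₂Sq.eval x = 4 * x ^ 3 + 4 * a * x + 4 * b := by
  simp only [WeierstrassCurve.Ψ₂Sq, WeierstrassCurve.b₂, WeierstrassCurve.b₄,
    WeierstrassCurve.b₆, eval_add, eval_mul, eval_C, eval_X, eval_pow]
  ring

/-- `Ψ₃(x) = 3x⁴ + 6ax² + 12bx − a²`. [cite: SilvermanAEC2009, Exercise 3.7 (PDF pp. 97–98)] -/
theorem eval_Ψ₃ (a b x : R) :
    (shortCurve a b).Ψ₃.eval x = 3 * x ^ 4 + 6 * a * x ^ 2 + 12 * b * x - a ^ 2 := by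
  simp only [WeierstrassCurve.Ψ₃, WeierstrassCurve.b₂, WeierstrassCurve.b₄,
    WeierstrassCurve.b₆, WeierstrassCurve.b₈, eval_add, eval_mul, eval_C, eval_X, eval_pow,
    eval_ofNat]
  ring

/-- `preΨ₄(x) = 2x⁶ + 10ax⁴ + 40bx³ − 10a²x² − 8abx − 2a³ − 16b²` (`ψ₄ = preΨ₄ · 2y`).
[cite: SilvermanAEC2009, Exercise 3.7 (PDF pp. 97–98)] -/
theorem eval_preΨ₄ (a b x : R) :
    (shortCurve a b).preΨ₄.eval x =
      2 * x ^ 6 + 10 * a * x ^ 4 + 40 * b * x ^ 3 - 10 * a ^ 2 * x ^ 2 - 8 * a * b * x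
        - 2 * a ^ 3 - 16 * b ^ 2 := by
  simp only [WeierstrassCurve.preΨ₄, WeierstrassCurve.b₂, WeierstrassCurve.b₄,
    WeierstrassCurve.b₆, WeierstrassCurve.b₈, eval_add, eval_mul, eval_C, eval_X,
    eval_pow, eval_ofNat]
  ring

/-- **`ψ₅` of `y² = x³ + ax + b`, in full**:
`ψ₅ = 5x¹² + 62ax¹⁰ + 380bx⁹ − 105a²x⁸ + 240abx⁷ − (300a³ + 240b²)x⁶ − 696a²bx⁵ − (125a⁴ + 1920ab²)x⁴
 − (80a³b + 1600b³)x³ − (50a⁵ + 240a²b²)x² − (100a⁴b + 640ab³)x + a⁶ − 32a³b² − 256b⁴`.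
[cite: SilvermanAEC2009, Exercise 3.7 (PDF pp. 97–98)] -/
theorem eval_preΨ'_five (a b x : R) :
    ((shortCurve a b).preΨ' 5).eval x =
      5 * x ^ 12 + 62 * a * x ^ 10 + 380 * b * x ^ 9 - 105 * a ^ 2 * x ^ 8 + 240 * a * b * x ^ 7
        - (300 * a ^ 3 + 240 * b ^ 2) * x ^ 6 - 696 * a ^ 2 * b * x ^ 5
        - (125 * a ^ 4 + 1920 * a * b ^ 2) * x ^ 4 - (80 * a ^ 3 * b + 1600 * b ^ 3) * x ^ 3
        - (50 * a ^ 5 + 240 * a ^ 2 * b ^ 2) * x ^ 2 - (100 * a ^ 4 * b + 640 * a * b ^ 3) * x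
        + (a ^ 6 - 32 * a ^ 3 * b ^ 2 - 256 * b ^ 4) := by
  rw [preΨ'_five, eval_sub, eval_mul, eval_pow, eval_pow, eval_Ψ₂Sq, eval_Ψ₃, eval_preΨ₄]
  ring

/-- **`ψ₇` of `y² = x³ + ax`** (`j = 1728`):
`ψ₇ = 7x²⁴ + 308ax²² − 2954a²x²⁰ − 19852a³x¹⁸ − 35231a⁴x¹⁶ − 82264a⁵x¹⁴ − 111916a⁶x¹² − 42168a⁷x¹⁰
 + 15673a⁸x⁸ + 14756a⁹x⁶ + 1302a¹⁰x⁴ + 196a¹¹x² − a¹²`. [cite: SilvermanAEC2009, Exercise 3.7 (PDF pp. 97–98)] -/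
theorem eval_preΨ'_seven_of_b_zero (a x : R) :
    ((shortCurve a 0).preΨ' 7).eval x =
      7 * x ^ 24 + 308 * a * x ^ 22 - 2954 * a ^ 2 * x ^ 20 - 19852 * a ^ 3 * x ^ 18
        - 35231 * a ^ 4 * x ^ 16 - 82264 * a ^ 5 * x ^ 14 - 111916 * a ^ 6 * x ^ 12
        - 42168 * a ^ 7 * x ^ 10 + 15673 * a ^ 8 * x ^ 8 + 14756 * a ^ 9 * x ^ 6
        + 1302 * a ^ 10 * x ^ 4 + 196 * a ^ 11 * x ^ 2 - a ^ 12 := by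
  rw [preΨ'_seven, eval_sub, eval_mul, eval_mul, eval_pow, eval_pow, eval_pow, eval_preΨ'_five,
    eval_Ψ₃, eval_preΨ₄, eval_Ψ₂Sq]
  ring

/-- **`ψ₇` of `y² = x³ + b`** (`j = 0`):
`ψ₇ = 7x²⁴ + 3944bx²¹ − 42896b²x¹⁸ − 829696b³x¹⁵ − 928256b⁴x¹² − 1555456b⁵x⁹ − 2809856b⁶x⁶
 − 802816b⁷x³ + 65536b⁸`. [cite: SilvermanAEC2009, Exercise 3.7 (PDF pp. 97–98)] -/
theorem eval_preΨ'_seven_of_a_zero (b x : R) :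
    ((shortCurve 0 b).preΨ' 7).eval x =
      7 * x ^ 24 + 3944 * b * x ^ 21 - 42896 * b ^ 2 * x ^ 18 - 829696 * b ^ 3 * x ^ 15
        - 928256 * b ^ 4 * x ^ 12 - 1555456 * b ^ 5 * x ^ 9 - 2809856 * b ^ 6 * x ^ 6
        - 802816 * b ^ 7 * x ^ 3 + 65536 * b ^ 8 := by
  rw [preΨ'_seven, eval_sub, eval_mul, eval_mul, eval_pow, eval_pow, eval_pow, eval_preΨ'_five,
    eval_Ψ₃, eval_preΨ₄, eval_Ψ₂Sq]
  ring

/-! ## §3 Transport along ring maps -/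

/-- `(y² = x³ + ax + b) ⊗_f S = (y² = x³ + f(a)x + f(b))`. [folklore] -/
theorem map_shortCurve {S : Type*} [CommRing S] (f : R →+* S) (a b : R) :
    (shortCurve a b).map f = shortCurve (f a) (f b) := by
  simp [WeierstrassCurve.map]

/-- `f(ψₙ(x)) = ψₙ(f(x))` for the short curve pushed forward along `f` (Mathlib's
`WeierstrassCurve.map_preΨ'`). [folklore] -/
theorem ringHom_eval_preΨ' {S : Type*} [CommRing S] (f : R →+* S) (a b x : R) (n : ℕ) :
    f (((shortCurve a b).preΨ' n).eval x) = ((shortCurve (f a) (f b)).preΨ' n).eval (f x) := by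
  rw [← map_shortCurve, WeierstrassCurve.map_preΨ', eval_map, eval₂_at_apply]

/-! ## §4 The congruences -/

/-- **`ψ₅(x) − (5x¹² + 380·b·x⁹) ∈ (a, b²)`** for `y² = x³ + ax + b` over any commutative ring
(`380 = 5·76`; the coefficient of `b` in `ψ₅` to first order). [cite: SilvermanAEC2009, Exercise 3.7 (PDF pp. 97–98)] -/
theorem eval_preΨ'_five_sub_mem (a b x : R) :
    ((shortCurve a b).preΨ' 5).eval x - (5 * x ^ 12 + 380 * b * x ^ 9) ∈
      Ideal.span ({a, b ^ 2} : Set R) := by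
  rw [eval_preΨ'_five]
  have ha : a ∈ Ideal.span ({a, b ^ 2} : Set R) := Ideal.subset_span (by simp)
  have hb : b ^ 2 ∈ Ideal.span ({a, b ^ 2} : Set R) := Ideal.subset_span (by simp)
  have e : 5 * x ^ 12 + 62 * a * x ^ 10 + 380 * b * x ^ 9 - 105 * a ^ 2 * x ^ 8
        + 240 * a * b * x ^ 7 - (300 * a ^ 3 + 240 * b ^ 2) * x ^ 6 - 696 * a ^ 2 * b * x ^ 5
        - (125 * a ^ 4 + 1920 * a * b ^ 2) * x ^ 4 - (80 * a ^ 3 * b + 1600 * b ^ 3) * x ^ 3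
        - (50 * a ^ 5 + 240 * a ^ 2 * b ^ 2) * x ^ 2 - (100 * a ^ 4 * b + 640 * a * b ^ 3) * x
        + (a ^ 6 - 32 * a ^ 3 * b ^ 2 - 256 * b ^ 4) - (5 * x ^ 12 + 380 * b * x ^ 9) =
      (62 * x ^ 10 - 105 * a * x ^ 8 + 240 * b * x ^ 7 - 300 * a ^ 2 * x ^ 6 - 696 * a * b * x ^ 5
          - 125 * a ^ 3 * x ^ 4 - 1920 * b ^ 2 * x ^ 4 - 80 * a ^ 2 * b * x ^ 3 - 50 * a ^ 4 * x ^ 2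
          - 240 * a * b ^ 2 * x ^ 2 - 100 * a ^ 3 * b * x - 640 * b ^ 3 * x + a ^ 5
          - 32 * a ^ 2 * b ^ 2) * a
        + (-240 * x ^ 6 - 1600 * b * x ^ 3 - 256 * b ^ 2) * b ^ 2 := by
    ring
  rw [e]
  exact add_mem (Ideal.mul_mem_left _ _ ha) (Ideal.mul_mem_left _ _ hb)

/-- The complementary congruence at `5`: **`ψ₅(x) − (5x¹² + 62·a·x¹⁰) ∈ (a², b)`** — the
coefficient `62` of `a` is prime to `5` (whence `5`-torsion with additive reduction at `5` lives
exactly on `v₅(a) = 1`). [cite: SilvermanAEC2009, Exercise 3.7 (PDF pp. 97–98)] -/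
theorem eval_preΨ'_five_sub_mem' (a b x : R) :
    ((shortCurve a b).preΨ' 5).eval x - (5 * x ^ 12 + 62 * a * x ^ 10) ∈
      Ideal.span ({a ^ 2, b} : Set R) := by
  rw [eval_preΨ'_five]
  have ha : a ^ 2 ∈ Ideal.span ({a ^ 2, b} : Set R) := Ideal.subset_span (by simp)
  have hb : b ∈ Ideal.span ({a ^ 2, b} : Set R) := Ideal.subset_span (by simp)
  have e : 5 * x ^ 12 + 62 * a * x ^ 10 + 380 * b * x ^ 9 - 105 * a ^ 2 * x ^ 8
        + 240 * a * b * x ^ 7 - (300 * a ^ 3 + 240 * b ^ 2) * x ^ 6 - 696 * a ^ 2 * b * x ^ 5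
        - (125 * a ^ 4 + 1920 * a * b ^ 2) * x ^ 4 - (80 * a ^ 3 * b + 1600 * b ^ 3) * x ^ 3
        - (50 * a ^ 5 + 240 * a ^ 2 * b ^ 2) * x ^ 2 - (100 * a ^ 4 * b + 640 * a * b ^ 3) * x
        + (a ^ 6 - 32 * a ^ 3 * b ^ 2 - 256 * b ^ 4) - (5 * x ^ 12 + 62 * a * x ^ 10) =
      (-105 * x ^ 8 - 300 * a * x ^ 6 - 125 * a ^ 2 * x ^ 4 - 50 * a ^ 3 * x ^ 2 + a ^ 4) * a ^ 2
        + (380 * x ^ 9 + 240 * a * x ^ 7 - 240 * b * x ^ 6 - 696 * a ^ 2 * x ^ 5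
          - 1920 * a * b * x ^ 4 - 80 * a ^ 3 * x ^ 3 - 1600 * b ^ 2 * x ^ 3 - 240 * a ^ 2 * b * x ^ 2
          - 100 * a ^ 4 * x - 640 * a * b ^ 2 * x - 32 * a ^ 3 * b - 256 * b ^ 3) * b := by
    ring
  rw [e]
  exact add_mem (Ideal.mul_mem_left _ _ ha) (Ideal.mul_mem_left _ _ hb)

/-- **`ψ₇(x) − (7x²⁴ + 308·a·x²²) ∈ (a², b)`** for `y² = x³ + ax + b` over any commutative ring
(`308 = 7·44`; the coefficient of `a` in `ψ₇` to first order). Read in `R/(a², b)`, where the curve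
is `y² = x³ + āx` with `ā² = 0`. [cite: SilvermanAEC2009, Exercise 3.7 (PDF pp. 97–98)] -/
theorem eval_preΨ'_seven_sub_mem (a b x : R) :
    ((shortCurve a b).preΨ' 7).eval x - (7 * x ^ 24 + 308 * a * x ^ 22) ∈
      Ideal.span ({a ^ 2, b} : Set R) := by
  rw [← Ideal.Quotient.eq_zero_iff_mem, map_sub, ringHom_eval_preΨ']
  set π := Ideal.Quotient.mk (Ideal.span ({a ^ 2, b} : Set R)) with hπ
  have hb : π b = 0 := Ideal.Quotient.eq_zero_iff_mem.mpr (Ideal.subset_span (by simp))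
  have ha : π a ^ 2 = 0 := by
    rw [← map_pow]; exact Ideal.Quotient.eq_zero_iff_mem.mpr (Ideal.subset_span (by simp))
  rw [hb, eval_preΨ'_seven_of_b_zero]
  simp only [map_add, map_mul, map_pow, map_ofNat]
  linear_combination (-2954 * π x ^ 20 - 19852 * π a * π x ^ 18 - 35231 * π a ^ 2 * π x ^ 16
    - 82264 * π a ^ 3 * π x ^ 14 - 111916 * π a ^ 4 * π x ^ 12 - 42168 * π a ^ 5 * π x ^ 10
    + 15673 * π a ^ 6 * π x ^ 8 + 14756 * π a ^ 7 * π x ^ 6 + 1302 * π a ^ 8 * π x ^ 4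
    + 196 * π a ^ 9 * π x ^ 2 - π a ^ 10) * ha

/-- The complementary congruence at `7`: **`ψ₇(x) − (7x²⁴ + 3944·b·x²¹) ∈ (a, b²)`** — the
coefficient `3944 = 7·563 + 3` of `b` is prime to `7` (whence `7`-torsion with additive reduction
at `7` lives exactly on `v₇(b) = 1`). Read in `R/(a, b²)`, where the curve is `y² = x³ + b̄` with
`b̄² = 0`. [cite: SilvermanAEC2009, Exercise 3.7 (PDF pp. 97–98)] -/
theorem eval_preΨ'_seven_sub_mem' (a b x : R) :
    ((shortCurve a b).preΨ' 7).eval x - (7 * x ^ 24 + 3944 * b * x ^ 21) ∈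
      Ideal.span ({a, b ^ 2} : Set R) := by
  rw [← Ideal.Quotient.eq_zero_iff_mem, map_sub, ringHom_eval_preΨ']
  set π := Ideal.Quotient.mk (Ideal.span ({a, b ^ 2} : Set R)) with hπ
  have ha : π a = 0 := Ideal.Quotient.eq_zero_iff_mem.mpr (Ideal.subset_span (by simp))
  have hb : π b ^ 2 = 0 := by
    rw [← map_pow]; exact Ideal.Quotient.eq_zero_iff_mem.mpr (Ideal.subset_span (by simp))
  rw [ha, eval_preΨ'_seven_of_a_zero]
  simp only [map_add, map_mul, map_pow, map_ofNat]
  linear_combination (-42896 * π x ^ 18 - 829696 * π b * π x ^ 15 - 928256 * π b ^ 2 * π x ^ 12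
    - 1555456 * π b ^ 3 * π x ^ 9 - 2809856 * π b ^ 4 * π x ^ 6 - 802816 * π b ^ 5 * π x ^ 3
    + 65536 * π b ^ 6) * hb

/-- The zeroth-order congruence at any `n ∈ {5, 7}` is contained in the above; for the record,
**`ψ₅(x) − 5x¹² ∈ (a, b)`** and **`ψ₇(x) − 7x²⁴ ∈ (a, b)`** (the cuspidal specialisation
`ψₙ(x; 0, 0) = n·x^{(n²−1)/2}`). [cite: SilvermanAEC2009, Exercise 3.7(b) (PDF pp. 97–98)] -/
theorem eval_preΨ'_five_sub_mem_span_pair (a b x : R) :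
    ((shortCurve a b).preΨ' 5).eval x - 5 * x ^ 12 ∈ Ideal.span ({a, b} : Set R) ∧
      ((shortCurve a b).preΨ' 7).eval x - 7 * x ^ 24 ∈ Ideal.span ({a, b} : Set R) := by
  have ha : a ∈ Ideal.span ({a, b} : Set R) := Ideal.subset_span (by simp)
  have hb : b ∈ Ideal.span ({a, b} : Set R) := Ideal.subset_span (by simp)
  constructor
  · have h := eval_preΨ'_five_sub_mem a b x
    have hle : Ideal.span ({a, b ^ 2} : Set R) ≤ Ideal.span ({a, b} : Set R) := by
      rw [Ideal.span_le]
      rintro z (rfl | rfl)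
      · exact ha
      · rw [pow_two]; exact Ideal.mul_mem_left _ _ hb
    have e : ((shortCurve a b).preΨ' 5).eval x - 5 * x ^ 12 =
        (((shortCurve a b).preΨ' 5).eval x - (5 * x ^ 12 + 380 * b * x ^ 9)) + (380 * x ^ 9) * b := by
      ring
    rw [e]
    exact add_mem (hle h) (Ideal.mul_mem_left _ _ hb)
  · have h := eval_preΨ'_seven_sub_mem a b x
    have hle : Ideal.span ({a ^ 2, b} : Set R) ≤ Ideal.span ({a, b} : Set R) := by
      rw [Ideal.span_le]
      rintro z (rfl | rfl)
      · rw [pow_two]; exact Ideal.mul_mem_left _ _ ha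
      · exact hb
    have e : ((shortCurve a b).preΨ' 7).eval x - 7 * x ^ 24 =
        (((shortCurve a b).preΨ' 7).eval x - (7 * x ^ 24 + 308 * a * x ^ 22)) + (308 * x ^ 22) * a := by
      ring
    rw [e]
    exact add_mem (hle h) (Ideal.mul_mem_left _ _ ha)

end Summit.BirchSwinnertonDyer.Rank1Residual.Additive.CuspTorsion

end
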